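import Summits.AtomisticToContinuum.Crystallization.Theorems.ChartedZeroExcessLayeredLatticeLiouvilleZZZYRCZQ

/-!
# Charted zero-excess layered-lattice Liouville — ZZZYRCZS: the two WINDOW-TYPE SYMMETRIES (r1867 (R6)) and the letter-free OUT-PAIR
cut (r1867 (R3)) for letter sequences

Cell `decomp-a2c`, lens 2, generation 100.  Census «WINSPLIT57» counts window types `{±1}^{2H₀}` up to the group ⟨reversal, sign flip⟩
(1 024 → 272 orbits at `H₀ = 5`); ruling r1867 (R6) licenses production over orbit representatives ONLY through two invariance lemmas on the
letter-function layer.  They are typed here, on `ℓ : ℤ → ℤ` directly (a window type is the restriction of `ℓ`), each with its explicit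
SITE MAP and KEY RELABELLING, so that hand-1's windowed kernel RCXR inherits them sum by sum:

§1 MIRROR (global sign flip of the step pattern = letter map `0 ↦ 0, 1 ↦ 2, 2 ↦ 1`, `mirrorLetters`): the site map
   `(γ, m) ↦ (−γ − χ(ℓ m)·(1,1), m)` (`χ c = [c ≠ 0]`, `mirrorSite`) NEGATES both refined in-plane coordinates (`refF0_mirror`, `refF1_mirror`),
   hence `n9F_mirror`, `d18F_mirror`, `sinSq0F_mirror`, `idealNearF_mirror`; key relabelling `Δγ ↦ −Δγ − (χ(ℓ m') − χ(ℓ m))·(1,1)`, `Δm ↦ Δm`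
   (`mirrorPair_dgamma`, `mirrorPair_layers`); letters stay in `{0,1,2}` (`isLetterSeq_mirrorLetters`).
§2 REVERSAL (read the layers backwards about `c`, `revLetters c ℓ m = ℓ (c − m)`): the site map `(γ, m) ↦ (γ, c − m)` keeps the in-plane
   coordinates and negates `Δm` (`n9F_rev`, `d18F_rev`, `sinSq0F_rev`, `idealNearF_rev`, `revPair_dgamma`, `revPair_layers`); on the
   CONFIGURATION side reversal is a pure re-indexing `w ↦ (m ↦ w (c − m))` (`revConf`): `bondVec_rev`, `sinSqPair_rev`, `idealLengthCmpF_rev`,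
   `idealAngleCmpF_rev`, `isLayeredCrystal_rev`, and ★ `slabBoxF_rev` (same dials; slips `m ↦ −r (c−m−1)`, normal `−n`).
   (Reversal of the STEP pattern in census' sense = §2 ∘ §1, point inversion; sign flip = §1.)  The mirror's configuration-side map
   `w ↦ (m ↦ −w m + χ(ℓ m)•(g₁ + g₂))` shifts the index metric by `χ`, so for the mirror the route of record is IDEAL-SIDE relabelling only.
§3 OUT-PAIR CUT (r1867 (R3)): the letter-free ideal length `n9LF Δγ₀ Δγ₁ Δm Δreg` and the conservative near class `IdealNearLF hi x`
   («near if SOME relative registry `Δreg ∈ [−2, 2]` puts `n9 ≤ hi`»), with `n9F_eq_n9LF` and `idealNearLF_of_idealNearF`.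
-/

namespace Summit.AtomisticToContinuum.Crystallization.Theorems.ChartedZeroExcessLayeredLatticeLiouville

open scoped RealInnerProductSpace
open Summit.AtomisticToContinuum.Crystallization.Theorems.ChartedPlanarOrderRigidityDoor (E3)

/-! ### §1 the mirror (sign flip of the step pattern) -/

/-- `χ c = 0` for the letter `A = 0`, `1` for `B, C`. [g100] -/
def letterChi (c : ℤ) : ℤ := if c = 0 then 0 else 1

/-- the mirrored letter `0 ↦ 0`, `1 ↦ 2`, `2 ↦ 1`, written `3χ(c) − c` (no case split in the algebra). [g100] -/
def mirrorLetter (c : ℤ) : ℤ := 3 * letterChi c - c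

/-- the mirrored letter sequence. [g100] -/
def mirrorLetters (ℓ : ℤ → ℤ) (m : ℤ) : ℤ := mirrorLetter (ℓ m)

/-- the mirror's site map `(γ, m) ↦ (−γ − χ(ℓ m)·(1,1), m)`. [g100] -/
def mirrorSite (ℓ : ℤ → ℤ) (s : Cell 2 × ℤ) : Cell 2 × ℤ := (fun i => -s.1 i - letterChi (ℓ s.2), s.2)

/-- the mirror's pair map. [g100] -/
def mirrorPair (ℓ : ℤ → ℤ) (x : (Cell 2 × ℤ) × (Cell 2 × ℤ)) : (Cell 2 × ℤ) × (Cell 2 × ℤ) := (mirrorSite ℓ x.1, mirrorSite ℓ x.2)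

/-- mirrored letters stay in `{0,1,2}`. [g100] -/
theorem isLetterSeq_mirrorLetters {ℓ : ℤ → ℤ} (h : IsLetterSeq ℓ) : IsLetterSeq (mirrorLetters ℓ) := by
  intro m
  obtain ⟨h0, h2⟩ := h m
  unfold mirrorLetters mirrorLetter letterChi
  split_ifs with hc <;> omega

/-- the mirror negates the first refined coordinate. [g100] -/
theorem refF0_mirror (ℓ : ℤ → ℤ) (s : Cell 2 × ℤ) : refF0 (mirrorLetters ℓ) (mirrorSite ℓ s) = -refF0 ℓ s := by
  simp only [refF0, mirrorLetters, mirrorLetter, mirrorSite]; ring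

/-- the mirror negates the second refined coordinate. [g100] -/
theorem refF1_mirror (ℓ : ℤ → ℤ) (s : Cell 2 × ℤ) : refF1 (mirrorLetters ℓ) (mirrorSite ℓ s) = -refF1 ℓ s := by
  simp only [refF1, mirrorLetters, mirrorLetter, mirrorSite]; ring

/-- layers are kept by the mirror. [g100] -/
theorem mirrorPair_layers (ℓ : ℤ → ℤ) (x : (Cell 2 × ℤ) × (Cell 2 × ℤ)) :
    (mirrorPair ℓ x).1.2 = x.1.2 ∧ (mirrorPair ℓ x).2.2 = x.2.2 := ⟨rfl, rfl⟩

/-- KEY RELABELLING of the mirror: `Δγ_i ↦ −Δγ_i − (χ(ℓ m') − χ(ℓ m))`. [g100] -/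
theorem mirrorPair_dgamma (ℓ : ℤ → ℤ) (x : (Cell 2 × ℤ) × (Cell 2 × ℤ)) (i : Fin 2) :
    (mirrorPair ℓ x).2.1 i - (mirrorPair ℓ x).1.1 i = -(x.2.1 i - x.1.1 i) - (letterChi (ℓ x.2.2) - letterChi (ℓ x.1.2)) := by
  simp only [mirrorPair, mirrorSite]; ring

/-- ★ `n9F` is mirror-invariant. [g100] -/
theorem n9F_mirror (ℓ : ℤ → ℤ) (x : (Cell 2 × ℤ) × (Cell 2 × ℤ)) : n9F (mirrorLetters ℓ) (mirrorPair ℓ x) = n9F ℓ x := by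
  simp only [n9F, mirrorPair, refF0_mirror, refF1_mirror]
  simp only [mirrorSite]; ring

/-- ★ `d18F` is mirror-invariant. [g100] -/
theorem d18F_mirror (ℓ : ℤ → ℤ) (x q : (Cell 2 × ℤ) × (Cell 2 × ℤ)) :
    d18F (mirrorLetters ℓ) (mirrorPair ℓ x) (mirrorPair ℓ q) = d18F ℓ x q := by
  simp only [d18F, mirrorPair, refF0_mirror, refF1_mirror]
  simp only [mirrorSite]; ring

/-- `sinSq0F` is mirror-invariant. [g100] -/
theorem sinSq0F_mirror (ℓ : ℤ → ℤ) (x q : (Cell 2 × ℤ) × (Cell 2 × ℤ)) :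
    sinSq0F (mirrorLetters ℓ) (mirrorPair ℓ x) (mirrorPair ℓ q) = sinSq0F ℓ x q := by
  simp only [sinSq0F, n9F_mirror, d18F_mirror]

/-- the ideal near class is mirror-invariant. [g100] -/
theorem idealNearF_mirror (ℓ : ℤ → ℤ) (hi : ℤ) (x : (Cell 2 × ℤ) × (Cell 2 × ℤ)) :
    IdealNearF (mirrorLetters ℓ) hi (mirrorPair ℓ x) ↔ IdealNearF ℓ hi x := by
  simp only [IdealNearF, n9F_mirror]

/-! ### §2 the reversal (layers read backwards about `c`) -/

/-- the reversed letter sequence `m ↦ ℓ (c − m)`. [g100] -/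
def revLetters (c : ℤ) (ℓ : ℤ → ℤ) (m : ℤ) : ℤ := ℓ (c - m)

/-- the reversal's site map `(γ, m) ↦ (γ, c − m)`. [g100] -/
def revSite (c : ℤ) (s : Cell 2 × ℤ) : Cell 2 × ℤ := (s.1, c - s.2)

/-- the reversal's pair map (orientation of the pair kept). [g100] -/
def revPair (c : ℤ) (x : (Cell 2 × ℤ) × (Cell 2 × ℤ)) : (Cell 2 × ℤ) × (Cell 2 × ℤ) := (revSite c x.1, revSite c x.2)

/-- the reversed configuration `m ↦ w (c − m)` (a pure re-indexing of the layers). [g100] -/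
def revConf (c : ℤ) (w : ℤ → E3) (m : ℤ) : E3 := w (c - m)

/-- reversed letters stay in `{0,1,2}`. [g100] -/
theorem isLetterSeq_revLetters (c : ℤ) {ℓ : ℤ → ℤ} (h : IsLetterSeq ℓ) : IsLetterSeq (revLetters c ℓ) := fun m => h (c - m)

/-- KEY RELABELLING of the reversal: `Δγ ↦ Δγ`, `Δm ↦ −Δm`. [g100] -/
theorem revPair_dgamma (c : ℤ) (x : (Cell 2 × ℤ) × (Cell 2 × ℤ)) (i : Fin 2) :
    (revPair c x).2.1 i - (revPair c x).1.1 i = x.2.1 i - x.1.1 i := rfl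

/-- layers under the reversal. [g100] -/
theorem revPair_layers (c : ℤ) (x : (Cell 2 × ℤ) × (Cell 2 × ℤ)) :
    (revPair c x).2.2 - (revPair c x).1.2 = -(x.2.2 - x.1.2) := by
  simp only [revPair, revSite]; ring

/-- ★ `n9F` is reversal-invariant. [g100] -/
theorem n9F_rev (c : ℤ) (ℓ : ℤ → ℤ) (x : (Cell 2 × ℤ) × (Cell 2 × ℤ)) : n9F (revLetters c ℓ) (revPair c x) = n9F ℓ x := by
  simp only [n9F, refF0, refF1, revLetters, revPair, revSite, sub_sub_cancel]; ring

/-- ★ `d18F` is reversal-invariant. [g100] -/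
theorem d18F_rev (c : ℤ) (ℓ : ℤ → ℤ) (x q : (Cell 2 × ℤ) × (Cell 2 × ℤ)) :
    d18F (revLetters c ℓ) (revPair c x) (revPair c q) = d18F ℓ x q := by
  simp only [d18F, refF0, refF1, revLetters, revPair, revSite, sub_sub_cancel]; ring

/-- `sinSq0F` is reversal-invariant. [g100] -/
theorem sinSq0F_rev (c : ℤ) (ℓ : ℤ → ℤ) (x q : (Cell 2 × ℤ) × (Cell 2 × ℤ)) :
    sinSq0F (revLetters c ℓ) (revPair c x) (revPair c q) = sinSq0F ℓ x q := by
  simp only [sinSq0F, n9F_rev, d18F_rev]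

/-- the ideal near class is reversal-invariant. [g100] -/
theorem idealNearF_rev (c : ℤ) (ℓ : ℤ → ℤ) (hi : ℤ) (x : (Cell 2 × ℤ) × (Cell 2 × ℤ)) :
    IdealNearF (revLetters c ℓ) hi (revPair c x) ↔ IdealNearF ℓ hi x := by
  simp only [IdealNearF, n9F_rev]

/-- configuration side: the bond vector of the reversed configuration is the bond vector of the reversed pair. [g100] -/
theorem bondVec_rev (c : ℤ) (a b : E3) (w : ℤ → E3) (x : (Cell 2 × ℤ) × (Cell 2 × ℤ)) :
    bondVec a b (revConf c w) x = bondVec a b w (revPair c x) := rfl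

/-- the actual `sin²` of the reversed configuration. [g100] -/
theorem sinSqPair_rev (c : ℤ) (a b : E3) (w : ℤ → E3) (x q : (Cell 2 × ℤ) × (Cell 2 × ℤ)) :
    sinSqPair a b (revConf c w) x q = sinSqPair a b w (revPair c x) (revPair c q) := rfl

/-- the site map of the reversal is an involution. [g100] -/
theorem revPair_revPair (c : ℤ) (x : (Cell 2 × ℤ) × (Cell 2 × ℤ)) : revPair c (revPair c x) = x := by
  obtain ⟨⟨γ, m⟩, ⟨γ', m'⟩⟩ := x
  simp [revPair, revSite]

/-- `n9F` of the reversed letters on a pair = `n9F` on the reversed pair. [g100] -/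
theorem n9F_revLetters (c : ℤ) (ℓ : ℤ → ℤ) (x : (Cell 2 × ℤ) × (Cell 2 × ℤ)) : n9F (revLetters c ℓ) x = n9F ℓ (revPair c x) := by
  have h := n9F_rev c ℓ (revPair c x)
  rwa [revPair_revPair] at h

/-- `sinSq0F` of the reversed letters on two pairs = `sinSq0F` on the reversed pairs. [g100] -/
theorem sinSq0F_revLetters (c : ℤ) (ℓ : ℤ → ℤ) (x q : (Cell 2 × ℤ) × (Cell 2 × ℤ)) :
    sinSq0F (revLetters c ℓ) x q = sinSq0F ℓ (revPair c x) (revPair c q) := by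
  have h := sinSq0F_rev c ℓ (revPair c x) (revPair c q)
  rwa [revPair_revPair, revPair_revPair] at h

/-- ★ the LENGTH comparison transports along the reversal. [g100] -/
theorem idealLengthCmpF_rev (c : ℤ) {ℓ : ℤ → ℤ} {lam mu : ℝ} {a b : E3} {w : ℤ → E3} (h : IdealLengthCmpF ℓ lam mu a b w) :
    IdealLengthCmpF (revLetters c ℓ) lam mu a b (revConf c w) := by
  intro x
  rw [bondVec_rev, n9F_revLetters]
  exact h _

/-- ★ the ANGLE comparison transports along the reversal. [g100] -/
theorem idealAngleCmpF_rev (c : ℤ) {ℓ : ℤ → ℤ} {K η : ℝ} {a b : E3} {w : ℤ → E3} (h : IdealAngleCmpF ℓ K η a b w) :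
    IdealAngleCmpF (revLetters c ℓ) K η a b (revConf c w) := by
  intro x q hx hq
  rw [n9F_revLetters] at hx hq
  rw [sinSqPair_rev, sinSq0F_revLetters]
  exact h _ _ hx hq

/-- the index distance is reversal-invariant. [g100] -/
theorem dist_revSite (c : ℤ) (x y : Cell 2 × ℤ) : dist (revSite c x) (revSite c y) = dist x y := by
  rw [Prod.dist_eq, Prod.dist_eq]
  simp only [revSite, Int.dist_eq]
  congr 1
  push_cast
  rw [show ((c : ℝ) - x.2) - (c - y.2) = -(x.2 - y.2) by ring, abs_neg]

/-- ★ the co-Lipschitz property transports along the reversal. [g100] -/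
theorem isLayeredCrystal_rev (c : ℤ) {c₀ : ℝ} {a b : E3} {w : ℤ → E3} (h : IsLayeredCrystal c₀ a b w) :
    IsLayeredCrystal c₀ a b (revConf c w) := by
  intro x y
  have h' := h (revSite c x) (revSite c y)
  rw [dist_revSite] at h'
  exact h'

/-- ★ THE SLAB BOX transports along the reversal with the SAME dials (slips `m ↦ −r (c − m − 1)`, normal `−n`, heights
`m ↦ h (c − m − 1)`). [g100] -/
theorem slabBoxF_rev (c : ℤ) {ℓ : ℤ → ℤ} {aLo aHi s τ hLo hHi : ℝ} {L : E3 ≃L[ℝ] E3} {w : ℤ → E3}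
    (hB : SlabBoxF ℓ aLo aHi s τ hLo hHi L w) : SlabBoxF (revLetters c ℓ) aLo aHi s τ hLo hHi L (revConf c w) := by
  obtain ⟨a, n, r, h, haLo, haHi, hconf, hn, hg₁, hg₂, hr, hh, hrn, hstep⟩ := hB
  refine ⟨a, -n, fun m => -r (c - m - 1), fun m => h (c - m - 1), haLo, haHi, hconf, by rw [norm_neg, hn],
    by rw [inner_neg_right, hg₁, neg_zero], by rw [inner_neg_right, hg₂, neg_zero], fun m => by rw [norm_neg]; exact hr _,
    fun m => hh _, fun m => by rw [inner_neg_left, inner_neg_right, hrn, neg_neg], fun m => ?_⟩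
  have hs := hstep (c - m - 1)
  rw [show c - m - 1 + 1 = c - m by ring] at hs
  simp only [revConf, revLetters, show c - (m + 1) = c - m - 1 by ring]
  rw [show w (c - m - 1) - w (c - m) = -(w (c - m) - w (c - m - 1)) by abel, hs, smul_neg, neg_add, neg_add, ← neg_smul, ← neg_div,
    neg_sub]

/-! ### §3 the letter-free out-pair cut (r1867 (R3)) -/

/-- the LETTER-FREE ideal length (in ninths) of an index pair with relative registry `Δreg`: `qhex(3Δγ + Δreg) + 6Δm²`. [g100] -/
def n9LF (dγ₀ dγ₁ dm dreg : ℤ) : ℤ :=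
  (3 * dγ₀ + dreg) * (3 * dγ₀ + dreg) + (3 * dγ₀ + dreg) * (3 * dγ₁ + dreg) + (3 * dγ₁ + dreg) * (3 * dγ₁ + dreg) + 6 * dm ^ 2

/-- ★ THE OUT-PAIR NEAR CLASS OF RECORD: a pair counts as NEAR if SOME relative registry `Δreg ∈ [−2, 2]` puts its letter-free ideal
length at most `hi` (conservative fold over the registries an out-of-window endpoint may carry). [g100] -/
def IdealNearLF (hi : ℤ) (x : (Cell 2 × ℤ) × (Cell 2 × ℤ)) : Prop :=
  ∃ dreg : ℤ, -2 ≤ dreg ∧ dreg ≤ 2 ∧ n9LF (x.2.1 0 - x.1.1 0) (x.2.1 1 - x.1.1 1) (x.2.2 - x.1.2) dreg ≤ hi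

/-- the ideal length of a letter sequence IS the letter-free length at the actual relative registry `ℓ m' − ℓ m`. [g100] -/
theorem n9F_eq_n9LF (ℓ : ℤ → ℤ) (x : (Cell 2 × ℤ) × (Cell 2 × ℤ)) :
    n9F ℓ x = n9LF (x.2.1 0 - x.1.1 0) (x.2.1 1 - x.1.1 1) (x.2.2 - x.1.2) (ℓ x.2.2 - ℓ x.1.2) := by
  simp only [n9F, n9LF, refF0, refF1]; ring

/-- ★ the cut rule is CONSERVATIVE: every ideal-near pair of a letter sequence is letter-free near. [g100] -/
theorem idealNearLF_of_idealNearF {ℓ : ℤ → ℤ} (h012 : IsLetterSeq ℓ) {hi : ℤ} {x : (Cell 2 × ℤ) × (Cell 2 × ℤ)}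
    (h : IdealNearF ℓ hi x) : IdealNearLF hi x := by
  obtain ⟨h0, h2⟩ := h012 x.1.2
  obtain ⟨h0', h2'⟩ := h012 x.2.2
  refine ⟨ℓ x.2.2 - ℓ x.1.2, by omega, by omega, ?_⟩
  rw [← n9F_eq_n9LF]; exact h

/-- conversely a letter-free FAR pair (`hi < n9LF` at every admissible registry) is ideal-far for every letter sequence. [g100] -/
theorem not_idealNearF_of_forall {ℓ : ℤ → ℤ} (h012 : IsLetterSeq ℓ) {hi : ℤ} {x : (Cell 2 × ℤ) × (Cell 2 × ℤ)}
    (h : ∀ dreg : ℤ, -2 ≤ dreg → dreg ≤ 2 → hi < n9LF (x.2.1 0 - x.1.1 0) (x.2.1 1 - x.1.1 1) (x.2.2 - x.1.2) dreg) :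
    ¬IdealNearF ℓ hi x := fun hn => by
  obtain ⟨d, hd1, hd2, hle⟩ := idealNearLF_of_idealNearF h012 hn
  exact absurd hle (not_le.mpr (h d hd1 hd2))

end Summit.AtomisticToContinuum.Crystallization.Theorems.ChartedZeroExcessLayeredLatticeLiouville
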